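import Literature.Computability.AlgebraicComplexity.ValiantConjectureEquivProofs
import HarnessLib
import Summits.PneNP.PneNP.Theorems.VPNeVNPComplex

/-!
# Valiant's hypothesis through an arbitrary `VNP`-complete family

`Literature.Computability.AlgebraicComplexity.VPNeVNPComplex` (`VP ℂ ≠ VNP ℂ`,
`ValiantConjecture.lean`) is **Valiant's hypothesis** over `ℂ`, an OPEN conjecture (Valiant 1979;
Bürgisser–Clausen–Shokrollahi 1997, (21.19) "Valiant's Hypothesis. VP ≠ VNP over any field",
p. 549, and open Problem 21.4, p. 574; Bürgisser 2024, §2: "widely open and considered the holy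
grail of algebraic complexity theory"). It stays a `def … : Prop` and is asserted nowhere. This
file proves the printed *reformulation* of the hypothesis through complete families, in the
generality in which it is printed:

> von zur Gathen 1987, §4: "Valiant's hypothesis is the conjecture that some p-definable
> polynomials are not p-computable. It holds if and only if each p-complete polynomial is not
> p-computable." (Prop. 4.8 there; Bürgisser 2024, §2.8: "Valiant's conjecture is equivalent to
> proving `(f_n) ∉ VP` for any such `VNP`-complete sequence.")

The sibling file `ValiantConjectureEquivProofs.lean` proves the instance `f = PER` in
characteristic `≠ 2` (`isPComputable_perPoly_iff_VP_eq_VNP`, and the discharge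
`perNotPComputableComplex_iff_holds`). Here:

* `VP_ne_VNP_iff_not_VNP_subset`: with `VP ⊆ VNP` (`VP_subset_VNP_holds`), `VP k ≠ VNP k` is
  `¬ VNP k ⊆ VP k` (BCS 1997, §21.5, p. 561: "the hypothesis `VNP ∖ VP ≠ ∅`");
* `VNP_subset_VP_of_isVNPComplete`, `VP_eq_VNP_iff_isVPFamily_of_isVNPComplete`,
  `VP_ne_VNP_iff_not_isPComputable_of_isVNPComplete`: for ANY `VNP`-complete family `f` over any
  commutative semiring, `VP = VNP ↔ f ∈ VP` and `VP ≠ VNP ↔ f` is not p-computable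
  (von zur Gathen 1987, Prop. 4.8; BCS 1997, Rem. (21.13)(2) with Def. (21.14));
* `VP_ne_VNP_iff_not_isPComputable_hcPoly`, `VPNeVNPComplex_iff_not_isPComputable_hcPoly`: the
  instance `f = HC` over every field (in particular in characteristic `2`, where `PER = DET ∈ VP`
  is useless), CONDITIONAL on the tree's undischarged named fact `isVNPComplete_hcPoly k`
  (Valiant 1979; BCS 1997, Thm. (21.17)(1); von zur Gathen 1987, Thm. 5.6), taken as a hypothesis;
* `VPNeVNPComplex_iff_perFamily_not_mem_VP`: the unconditional standard form over `ℂ`,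
  `VP_ℂ ≠ VNP_ℂ ↔ PER ∉ VP_ℂ` (from `perFamily_mem_VP_iff_VP_eq_VNP`).

## Proof

As in print (BCS 1997, p. 547: "Obviously, if `A` is NP-complete, then `P = NP` iff `A ∈ P`",
transported to `VP`/`VNP`): if a complete `f` lies in `VP`, every `g ∈ VNP` is a p-family and a
p-projection of `f` (Def. (21.14)), hence in `VP` by closure under p-projections
(Rem. (21.13)(2); `IsVPFamily.of_isPProjection_holds`), so `VNP ⊆ VP ⊆ VNP`; conversely
`VP = VNP ∋ f`. A complete family is a p-family (it is in `VNP`), so `f ∈ VP ↔ f` p-computable.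

## Design notes

* Theorems only; imports the sibling discharge file for `VP_subset_VNP_holds`,
  `ringChar_complex_ne_two`, `perFamily_mem_VP_iff_VP_eq_VNP`.
* Nothing here asserts or refutes `VPNeVNPComplex`; CONVENTIONS §4 (open conjectures are never
  theorems) is respected. The `HC` statements carry the named fact `isVNPComplete_hcPoly` as an
  explicit hypothesis (D-0014), so they are conditional until that fact is discharged.

## References

* J. von zur Gathen, *Feasible arithmetic computations: Valiant's hypothesis*, J. Symbolic
  Comput. 4 (1987), 137–172: Prop. 2.14(ii), §4, Def. 4.7, Prop. 4.8, Thm. 5.4, Thm. 5.6.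
* P. Bürgisser, M. Clausen, M. A. Shokrollahi, *Algebraic Complexity Theory*, Grundlehren 315,
  Springer 1997: Def. (21.8) p. 546, p. 547, Rem. (21.13)(2) p. 548, Def. (21.14) p. 548,
  Thm. (21.17) and (21.19) p. 549, §21.5 p. 561, Problem 21.4 p. 574.
* P. Bürgisser, *Completeness and Reduction in Algebraic Complexity Theory*, Springer 2000,
  Thm. 2.10, Rem. 2.11.
* P. Bürgisser, *Completeness classes in algebraic complexity theory*, arXiv:2406.06217 (2024),
  §2 (Valiant's conjecture, Rem. 2.26), §2.8.
* L. G. Valiant, *Completeness classes in algebra*, Proc. 11th ACM STOC (1979), 249–261.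
-/

noncomputable section

open MvPolynomial

namespace Literature.Computability.AlgebraicComplexity

universe u v

section Classes

variable (k : Type u) [CommSemiring k]

/-- Since `VP ⊆ VNP` (`VP_subset_VNP_holds`), Valiant's hypothesis `VP k ≠ VNP k` says exactly
that the inclusion is strict: `¬ VNP k ⊆ VP k` (BCS 1997, §21.5, p. 561, "the hypothesis
`VNP ∖ VP ≠ ∅`"; von zur Gathen 1987, §4: "there exist p-definable families of polynomials that
are not p-computable"). [cite: BurgisserClausenShokrollahi1997, §21.5 p. 561] -/
theorem VP_ne_VNP_iff_not_VNP_subset : VP k ≠ VNP k ↔ ¬ VNP k ⊆ VP k := by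
  constructor
  · exact fun hne h => hne (Set.Subset.antisymm (VP_subset_VNP_holds k) h)
  · exact fun h hEq => h fun F hF => hEq.symm ▸ hF

end Classes

/-! ### The criterion for an arbitrary `VNP`-complete family (von zur Gathen 1987, Prop. 4.8) -/

section Complete

variable {k : Type u} [CommSemiring k] {σ : ℕ → Type v} [∀ n, Fintype (σ n)]

/-- If some `VNP`-complete family `f` lies in `VP`, then `VNP ⊆ VP`: every `g ∈ VNP` is a p-family
and a p-projection of `f` (BCS 1997, Def. (21.14)), hence in `VP`, which is closed under
p-projections among p-families (BCS 1997, Rem. (21.13)(2); von zur Gathen 1987, Prop. 2.14(ii);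
`IsVPFamily.of_isPProjection_holds`). [cite: BurgisserClausenShokrollahi1997, Rem. (21.13)(2) and Def. (21.14)] -/
theorem VNP_subset_VP_of_isVNPComplete {f : ∀ n, MvPolynomial (σ n) k} (hf : IsVNPComplete f)
    (hfVP : IsVPFamily f) : VNP k ⊆ VP k := by
  intro F hF
  have hF' : IsVNPFamily F.poly := hF
  have hproj : IsPProjection F.poly f := hf.2 F.nvars F.poly hF'
  show IsVPFamily F.poly
  exact IsVPFamily.of_isPProjection_holds hF'.1 hproj hfVP

/-- For a `VNP`-complete family `f`: `VP = VNP ↔ f ∈ VP` (BCS 1997, p. 547, "if `A` is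
NP-complete, then `P = NP` iff `A ∈ P`", in the `VP`/`VNP` setting of Def. (21.14) and
Rem. (21.13)(2); von zur Gathen 1987, Prop. 4.8). [cite: Vonzurgathen1987Feasible, Prop. 4.8] -/
theorem VP_eq_VNP_iff_isVPFamily_of_isVNPComplete {f : ∀ n, MvPolynomial (σ n) k}
    (hf : IsVNPComplete f) : VP k = VNP k ↔ IsVPFamily f := by
  constructor
  · intro h
    have hmem : PolyFamily.ofFintype f ∈ VNP k :=
      (mem_VNP_ofFintype_iff_holds (k := k) (σ := σ) f).2 hf.1
    rw [← h] at hmem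
    exact (mem_VP_ofFintype_iff_holds (k := k) (σ := σ) f).1 hmem
  · exact fun hfVP =>
      Set.Subset.antisymm (VP_subset_VNP_holds k) (VNP_subset_VP_of_isVNPComplete hf hfVP)

/-- **von zur Gathen 1987, Prop. 4.8** ("Let `f` be a p-complete family over `F`. Then Valiant's
hypothesis holds over `F` if and only if `f` is not p-computable"; §4: "It holds if and only if
each p-complete polynomial is not p-computable"; Bürgisser 2024, §2.8), for an arbitrary
`VNP`-complete family `f` over a commutative semiring: `VP k ≠ VNP k ↔ ¬ IsPComputable f`
(a complete family is a p-family, so `f ∈ VP` iff `f` is p-computable). [cite: Vonzurgathen1987Feasible, §4 and Prop. 4.8] -/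
theorem VP_ne_VNP_iff_not_isPComputable_of_isVNPComplete {f : ∀ n, MvPolynomial (σ n) k}
    (hf : IsVNPComplete f) : VP k ≠ VNP k ↔ ¬ IsPComputable f :=
  (not_congr (VP_eq_VNP_iff_isVPFamily_of_isVNPComplete hf)).trans
    (not_congr ⟨fun h => h.2, fun h => ⟨hf.1.1, h⟩⟩)

end Complete

/-! ### Instances: `HC` over every field (conditional on `isVNPComplete_hcPoly`), `PER` over `ℂ` -/

section Hamiltonian

variable (k : Type u) [Field k]

/-- Over every field `k` — in particular in characteristic `2`, where the permanent is the
determinant and lies in `VP` — Valiant's hypothesis `VP k ≠ VNP k` holds iff the Hamiltonian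
cycle family `(HC_n)_n` is not p-computable, GIVEN the `VNP`-completeness of `HC` over every
field (the tree's named fact `isVNPComplete_hcPoly k`, not yet discharged: Valiant 1979;
BCS 1997, Thm. (21.17)(1); von zur Gathen 1987, Thm. 5.6 "Over any field, HC is p-complete",
and §4: "In characteristic two, we use the p-complete family of Hamiltonian cycle polynomials
instead of PER"). Conditional on that fact (D-0014). [cite: Vonzurgathen1987Feasible, Prop. 4.8 and Thm. 5.6] -/
theorem VP_ne_VNP_iff_not_isPComputable_hcPoly (h : isVNPComplete_hcPoly k) :
    VP k ≠ VNP k ↔ ¬ IsPComputable fun n => hcPoly (Fin n) k :=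
  VP_ne_VNP_iff_not_isPComputable_of_isVNPComplete h

/-- Over `ℂ`: `VPNeVNPComplex ↔ (HC_n)_n` is not p-computable over `ℂ`, conditional on the named
fact `isVNPComplete_hcPoly ℂ` (Valiant 1979; BCS 1997, Thm. (21.17)(1); von zur Gathen 1987,
Prop. 4.8 with Thm. 5.6). The left-hand side is Valiant's hypothesis, an open conjecture. [cite: Vonzurgathen1987Feasible, Prop. 4.8 and Thm. 5.6] -/
theorem VPNeVNPComplex_iff_not_isPComputable_hcPoly (h : isVNPComplete_hcPoly ℂ) :
    Summit.PneNP.PneNP.VPNeVNPComplex ↔ ¬ IsPComputable fun n => hcPoly (Fin n) ℂ :=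
  VP_ne_VNP_iff_not_isPComputable_hcPoly ℂ h

end Hamiltonian

/-- The standard form of Valiant's hypothesis over `ℂ`: `VP_ℂ ≠ VNP_ℂ ↔ PER ∉ VP_ℂ`
(unconditional: `ringChar ℂ = 0 ≠ 2` and `perFamily_mem_VP_iff_VP_eq_VNP`; Bürgisser 2000,
Rem. 2.11 with Thm. 2.10; BCS 1997, Thm. (21.17)(2) with (21.19); Bürgisser 2024, §2.8). The
left-hand side remains an open conjecture (BCS 1997, Problem 21.4). [cite: Burgisser2000, Rem. 2.11] -/
theorem VPNeVNPComplex_iff_perFamily_not_mem_VP : Summit.PneNP.PneNP.VPNeVNPComplex ↔ perFamily ℂ ∉ VP ℂ :=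
  (not_congr (perFamily_mem_VP_iff_VP_eq_VNP ℂ ringChar_complex_ne_two)).symm

end Literature.Computability.AlgebraicComplexity
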